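import Summits.KontsevichZagierPeriods.KontsevichZagierPeriods.Theses.HyperbolicBloch
import Summits.KontsevichZagierPeriods.KontsevichZagierPeriods.Theorems.HyperbolicBlochOffTetraSectorKernelGlue
import Literature.NumberTheory.Transcendental.KZIdealTetrahedron
import Literature.NumberTheory.Transcendental.KZLogCalculusProofs

/-!
# `OffTetraSectorKernel` (stmt-KontsevichZagierPeriods-10557, route HyperbolicBloch) — line `deform-to-the-oracle`, skeleton v1

Lead prover-line-stmt-KontsevichZagierPeriods-10557-1. The line's unconditional rung is the ENVELOPE PRINCIPLE
(`offTetraSectorKernel_on_envelope`, landed in `…Glue.lean`): the crux HOLDS on every class that is move-equivalent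
to a tetrahedral combination, and its content lies entirely off that envelope. Stage 1 of the line puts the first
MIXED (planar-rational ↔ hyperbolic) identity on the envelope, the calibration of card `deform-to-the-oracle`
(`CatalanMeetsShadow ∧ ShadowSquareTetra` of `Cruxes/…/SketchIdeator2.lean` §3) = the unfiled layer-2 item
`TetrahedronCatalan` of route BianchiHumbert: **Catalan's square `[(0,1)², 1/(1+x²y²)]` is KZ-equivalent to the
ideal tetrahedron `[T(∞,0,1,i), t⁻³]`** (`catalanMeetsTetra`; both `= G = D(i) = 0.9159655942`), by an explicit chain
of eight moves, none of them Newton–Leibniz: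

* `stub_cayleyShear` (rule 2): `Φ(x,y) = ((1−xy)/(1+xy), 2x/(1+xy))`, `|det| = 4x/(1+xy)³`, maps the square
  `(0,1]×(0,1)` onto the band `B = {0<s<1, 1−s<y≤1+s}` and `1/(1+x²y²)` onto `g = 1/((1+s²)y)`;
* `stub_dissect` (rule 1a, six instances incl. two null edges): `B = M ∪ A`, `M = N ∪ T₁`, `T' = T₁ ∪ P`,
  `P = A ∪ A*` with `M = {1−s<y≤1}`, `A = {1<y≤1+s}`, `N = {1−s<y≤1−s²}`, `T₁ = {1−s²<y≤1}`, `P = {1<y≤2}`,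
  `A* = {1+s<y≤2}`, `T' = {1−s²<y≤2}` (all over `0<s<1`, all unions exact and disjoint);
* `stub_yScale` (rule 2): `y ↦ y/(1−s)` maps `N` onto `A` (`g` is `y`-homogeneous);
* `stub_putnam` (rule 2): the self-map `(s,y) ↦ ((1−s)/(1+s), 2y/(1+s))` of `∫₀¹ log(1+s)/(1+s²) ds = (π/8) log 2`
  maps `A` onto `A*`, so `2[A] ≡ [P]` — the `(π/8)·log 2` cancellation WITHOUT division by 2;
* `stub_aToY` (rule 2): `(a,s) ↦ (s, 2 − a(1+s²))`, `|det| = 1+s²`, maps `[[0,1)×(0,1), 1/(2−a(1+s²))]` onto `[T', g]`;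
* `stub_shadowSquare` (rules 2, 1a, 1b): `(a,s) ↦ (a(1+s)/2, a(1−s)/2)` maps `(0,1)×(−1,1)` onto the triangle
  `Δ(0,1,i)` and `1/(2(2−a(1+s²)))` onto the flat density `1/(2(q₀+q₁−q₀²−q₁²))` of `T(i)`; reflection `s ↦ −s`
  and `f = f/2 + f/2`; then the LANDED `tetraFlatten` at `z = i` (`…Bridge.lean`) reaches `[T(i), t⁻³]`.

Bookkeeping: `[K] ≡ [B] = [M]+[A] = [N]+[T₁]+[A] ≡ 2[A]+[T₁] ≡ [P]+[T₁] = [T'] ≡ [Tsq] ≡ [Δ-shadow] ≡ [T(i)]`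
(numerics `compute/catalan_chain_check.py`: set identities exact, Jacobian identities to 1e-16, values to 1e-9).

Transfer: the remainder `stub_offCatalan` is the crux with its oracle ENLARGED by the Catalan square; it is
crux-EQUIVALENT (`offTetraSectorKernel_iff_offCatalan`: the calibration turns every enlarged zero-sum into a
tetrahedral one, `[κ] ≡ [ρ i]`), hence summit-strength (`Cruxes/OffTetraSectorKernel/Disproof.lean` §1) — NOT a proof
target of the line. The sharp form of the residue is recorded as `offTetraSectorKernel_iff_envelopeKernel`: the crux
says exactly that every vanishing formal combination of periods is, modulo the moves, a ℤ-combination of the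
`KZ.idealTetrahedronRep z` (`z ∈ ℚ̄ ∩ ℍ⁺`).

Composition: `OffTetraSectorKernel_of := offTetraSectorKernel_iff_offCatalan.mpr stub_offCatalan`.
Disproof used: §1 (`of_summit`: remainder not claimed), §3 `false_without_evalZero` (spent once, in the oracle
exchange), `false_without_relations` (every stub produces relations), `false_without_newtonLeibniz` (honoured: the
remainder keeps rule 3; the calibration itself needs none), §5 no refuted strengthening restated.
-/

noncomputable section

open Set MeasureTheory
open Literature.NumberTheory.Transcendental

namespace Summit.KontsevichZagierPeriods.HyperbolicBloch.OffTetraSectorKernel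

/-! ## Stage 1 — the Catalan calibration (TetrahedronCatalan), registered stubs -/

/-- STUB `stub_cayleyShear` (rule 2, one `changeOfVariablesRel` instance + existence of the image representation):
the Cayley–shear map `Φ(x) = ((1 − x₀x₁)/(1 + x₀x₁), 2x₀/(1 + x₀x₁))` is `ℚ`-semialgebraic, injective and smooth on
the half-closed square `{0 < x₀ ≤ 1, 0 < x₁ < 1}`, maps it ONTO the band `{0 < s < 1, 1 − s < y ≤ 1 + s}`, has
`|det DΦ| = 4x₀/(1 + x₀x₁)³`, and `1/(1 + x₀²x₁²) = g(Φ x)·|det DΦ(x)|` with `g(s,y) = 1/((1 + s²) y)`.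
[cite: KontsevichZagier2001, §1.2 rule (2)] -/
theorem stub_cayleyShear : ∀ K : Literature.NumberTheory.Transcendental.KZ.IntegralRep 2, K.domain = {x | 0 < x 0 ∧ x 0 ≤ 1 ∧ 0 < x 1 ∧ x 1 < 1} → Set.EqOn K.integrand (fun x => 1 / (1 + x 0 ^ 2 * x 1 ^ 2)) K.domain → (∃ B : Literature.NumberTheory.Transcendental.KZ.IntegralRep 2, B.domain = {x | 0 < x 0 ∧ x 0 < 1 ∧ 1 - x 0 < x 1 ∧ x 1 ≤ 1 + x 0} ∧ Set.EqOn B.integrand (fun x => 1 / ((1 + x 0 ^ 2) * x 1)) B.domain) ∧ (∀ B : Literature.NumberTheory.Transcendental.KZ.IntegralRep 2, B.domain = {x | 0 < x 0 ∧ x 0 < 1 ∧ 1 - x 0 < x 1 ∧ x 1 ≤ 1 + x 0} → Set.EqOn B.integrand (fun x => 1 / ((1 + x 0 ^ 2) * x 1)) B.domain → Literature.NumberTheory.Transcendental.KZ.Equivalent K B) := by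
  sorry

/-- STUB `stub_dissect` (rule 1a and null pieces: the bookkeeper of the chain). Six dissections with EXACT unions, all
pieces with the integrand `g(s,y) = 1/((1+s²)y)` except the two squares: (i) the open unit square and the half-closed
square `(0,1]×(0,1)` carry equivalent Catalan representations (null edge `x₀ = 1`); (ii) `B = M ∪ A`;
(iii) `M = N ∪ T₁`; (iv) `T' = T₁ ∪ P`; (v) `P = A ∪ A*`; (vi) `[0,1)×(0,1)` versus the open square for the shadow-square
integrand `1/(2 − a(1+s²))` (null edge `a = 0`). Existence of the pieces is by `KZ.IntegralRep.restrict`.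
[cite: KontsevichZagier2001, §1.2 rule (1)] -/
theorem stub_dissect :
    (∀ κ : Literature.NumberTheory.Transcendental.KZ.IntegralRep 2, κ.domain = {x | 0 < x 0 ∧ x 0 < 1 ∧ 0 < x 1 ∧ x 1 < 1} → Set.EqOn κ.integrand (fun x => 1 / (1 + x 0 ^ 2 * x 1 ^ 2)) κ.domain → (∃ K : Literature.NumberTheory.Transcendental.KZ.IntegralRep 2, K.domain = {x | 0 < x 0 ∧ x 0 ≤ 1 ∧ 0 < x 1 ∧ x 1 < 1} ∧ Set.EqOn K.integrand (fun x => 1 / (1 + x 0 ^ 2 * x 1 ^ 2)) K.domain) ∧ (∀ K : Literature.NumberTheory.Transcendental.KZ.IntegralRep 2, K.domain = {x | 0 < x 0 ∧ x 0 ≤ 1 ∧ 0 < x 1 ∧ x 1 < 1} → Set.EqOn K.integrand (fun x => 1 / (1 + x 0 ^ 2 * x 1 ^ 2)) K.domain → Literature.NumberTheory.Transcendental.KZ.Equivalent κ K)) ∧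
    (∀ B : Literature.NumberTheory.Transcendental.KZ.IntegralRep 2, B.domain = {x | 0 < x 0 ∧ x 0 < 1 ∧ 1 - x 0 < x 1 ∧ x 1 ≤ 1 + x 0} → Set.EqOn B.integrand (fun x => 1 / ((1 + x 0 ^ 2) * x 1)) B.domain → (∃ M A : Literature.NumberTheory.Transcendental.KZ.IntegralRep 2, M.domain = {x | 0 < x 0 ∧ x 0 < 1 ∧ 1 - x 0 < x 1 ∧ x 1 ≤ 1} ∧ Set.EqOn M.integrand (fun x => 1 / ((1 + x 0 ^ 2) * x 1)) M.domain ∧ A.domain = {x | 0 < x 0 ∧ x 0 < 1 ∧ 1 < x 1 ∧ x 1 ≤ 1 + x 0} ∧ Set.EqOn A.integrand (fun x => 1 / ((1 + x 0 ^ 2) * x 1)) A.domain) ∧ (∀ M A : Literature.NumberTheory.Transcendental.KZ.IntegralRep 2, M.domain = {x | 0 < x 0 ∧ x 0 < 1 ∧ 1 - x 0 < x 1 ∧ x 1 ≤ 1} → Set.EqOn M.integrand (fun x => 1 / ((1 + x 0 ^ 2) * x 1)) M.domain → A.domain = {x | 0 < x 0 ∧ x 0 < 1 ∧ 1 < x 1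 ∧ x 1 ≤ 1 + x 0} → Set.EqOn A.integrand (fun x => 1 / ((1 + x 0 ^ 2) * x 1)) A.domain → Literature.NumberTheory.Transcendental.KZ.of B - Literature.NumberTheory.Transcendental.KZ.of M - Literature.NumberTheory.Transcendental.KZ.of A ∈ Literature.NumberTheory.Transcendental.KZ.relations)) ∧
    (∀ M : Literature.NumberTheory.Transcendental.KZ.IntegralRep 2, M.domain = {x | 0 < x 0 ∧ x 0 < 1 ∧ 1 - x 0 < x 1 ∧ x 1 ≤ 1} → Set.EqOn M.integrand (fun x => 1 / ((1 + x 0 ^ 2) * x 1)) M.domain → (∃ N T₁ : Literature.NumberTheory.Transcendental.KZ.IntegralRep 2, N.domain = {x | 0 < x 0 ∧ x 0 < 1 ∧ 1 - x 0 < x 1 ∧ x 1 ≤ 1 - x 0 ^ 2} ∧ Set.EqOn N.integrand (fun x => 1 / ((1 + x 0 ^ 2) * x 1)) N.domain ∧ T₁.domain = {x | 0 < x 0 ∧ x 0 < 1 ∧ 1 - x 0 ^ 2 < x 1 ∧ x 1 ≤ 1} ∧ Set.EqOn T₁.integrand (fun x => 1 / ((1 + x 0 ^ 2) * x 1)) T₁.domain)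 ∧ (∀ N T₁ : Literature.NumberTheory.Transcendental.KZ.IntegralRep 2, N.domain = {x | 0 < x 0 ∧ x 0 < 1 ∧ 1 - x 0 < x 1 ∧ x 1 ≤ 1 - x 0 ^ 2} → Set.EqOn N.integrand (fun x => 1 / ((1 + x 0 ^ 2) * x 1)) N.domain → T₁.domain = {x | 0 < x 0 ∧ x 0 < 1 ∧ 1 - x 0 ^ 2 < x 1 ∧ x 1 ≤ 1} → Set.EqOn T₁.integrand (fun x => 1 / ((1 + x 0 ^ 2) * x 1)) T₁.domain → Literature.NumberTheory.Transcendental.KZ.of M - Literature.NumberTheory.Transcendental.KZ.of N - Literature.NumberTheory.Transcendental.KZ.of T₁ ∈ Literature.NumberTheory.Transcendental.KZ.relations)) ∧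
    (∀ T' : Literature.NumberTheory.Transcendental.KZ.IntegralRep 2, T'.domain = {x | 0 < x 0 ∧ x 0 < 1 ∧ 1 - x 0 ^ 2 < x 1 ∧ x 1 ≤ 2} → Set.EqOn T'.integrand (fun x => 1 / ((1 + x 0 ^ 2) * x 1)) T'.domain → (∃ T₁ P : Literature.NumberTheory.Transcendental.KZ.IntegralRep 2, T₁.domain = {x | 0 < x 0 ∧ x 0 < 1 ∧ 1 - x 0 ^ 2 < x 1 ∧ x 1 ≤ 1} ∧ Set.EqOn T₁.integrand (fun x => 1 / ((1 + x 0 ^ 2) * x 1)) T₁.domain ∧ P.domain = {x | 0 < x 0 ∧ x 0 < 1 ∧ 1 < x 1 ∧ x 1 ≤ 2} ∧ Set.EqOn P.integrand (fun x => 1 / ((1 + x 0 ^ 2) * x 1)) P.domain) ∧ (∀ T₁ P : Literature.NumberTheory.Transcendental.KZ.IntegralRep 2, T₁.domain = {x | 0 < x 0 ∧ x 0 < 1 ∧ 1 - x 0 ^ 2 < x 1 ∧ x 1 ≤ 1} → Set.EqOn T₁.integrand (fun x => 1 / ((1 + x 0 ^ 2) * x 1)) T₁.domain → P.domain = {x |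 0 < x 0 ∧ x 0 < 1 ∧ 1 < x 1 ∧ x 1 ≤ 2} → Set.EqOn P.integrand (fun x => 1 / ((1 + x 0 ^ 2) * x 1)) P.domain → Literature.NumberTheory.Transcendental.KZ.of T' - Literature.NumberTheory.Transcendental.KZ.of T₁ - Literature.NumberTheory.Transcendental.KZ.of P ∈ Literature.NumberTheory.Transcendental.KZ.relations)) ∧
    (∀ P A As : Literature.NumberTheory.Transcendental.KZ.IntegralRep 2, P.domain = {x | 0 < x 0 ∧ x 0 < 1 ∧ 1 < x 1 ∧ x 1 ≤ 2} → Set.EqOn P.integrand (fun x => 1 / ((1 + x 0 ^ 2) * x 1)) P.domain → A.domain = {x | 0 < x 0 ∧ x 0 < 1 ∧ 1 < x 1 ∧ x 1 ≤ 1 + x 0} → Set.EqOn A.integrand (fun x => 1 / ((1 + x 0 ^ 2) * x 1)) A.domain → As.domain = {x | 0 < x 0 ∧ x 0 < 1 ∧ 1 + x 0 < x 1 ∧ x 1 ≤ 2} → Set.EqOn As.integrand (fun x => 1 / ((1 + x 0 ^ 2) * x 1)) As.domain → Literature.NumberTheory.Transcendental.KZ.of P - Literature.NumberTheory.Transcendental.KZ.of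 A - Literature.NumberTheory.Transcendental.KZ.of As ∈ Literature.NumberTheory.Transcendental.KZ.relations) ∧
    (∀ T : Literature.NumberTheory.Transcendental.KZ.IntegralRep 2, T.domain = {x | 0 ≤ x 0 ∧ x 0 < 1 ∧ 0 < x 1 ∧ x 1 < 1} → Set.EqOn T.integrand (fun x => 1 / (2 - x 0 * (1 + x 1 ^ 2))) T.domain → (∃ T₀ : Literature.NumberTheory.Transcendental.KZ.IntegralRep 2, T₀.domain = {x | 0 < x 0 ∧ x 0 < 1 ∧ 0 < x 1 ∧ x 1 < 1} ∧ Set.EqOn T₀.integrand (fun x => 1 / (2 - x 0 * (1 + x 1 ^ 2))) T₀.domain) ∧ (∀ T₀ : Literature.NumberTheory.Transcendental.KZ.IntegralRep 2, T₀.domain = {x | 0 < x 0 ∧ x 0 < 1 ∧ 0 < x 1 ∧ x 1 < 1} → Set.EqOn T₀.integrand (fun x => 1 / (2 - x 0 * (1 + x 1 ^ 2))) T₀.domain → Literature.NumberTheory.Transcendental.KZ.Equivalent T T₀)) := by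
  sorry

/-- STUB `stub_yScale` (rule 2, one `changeOfVariablesRel` instance): the fibrewise rescaling `Φ(s,y) = (s, y/(1−s))`,
`|det DΦ| = 1/(1−s)`, maps `N = {0<s<1, 1−s<y≤1−s²}` onto `A = {0<s<1, 1<y≤1+s}` and `g(s,y) = g(Φ(s,y))/(1−s)` for the
`y`-homogeneous integrand `g(s,y) = 1/((1+s²)y)`: `∫log(1+s)/(1+s²)` appears a second time.
[cite: KontsevichZagier2001, §1.2 rule (2)] -/
theorem stub_yScale : ∀ N A : Literature.NumberTheory.Transcendental.KZ.IntegralRep 2, N.domain = {x | 0 < x 0 ∧ x 0 < 1 ∧ 1 - x 0 < x 1 ∧ x 1 ≤ 1 - x 0 ^ 2} → Set.EqOn N.integrand (fun x => 1 / ((1 + x 0 ^ 2) * x 1)) N.domain → A.domain = {x | 0 < x 0 ∧ x 0 < 1 ∧ 1 < x 1 ∧ x 1 ≤ 1 + x 0} → Set.EqOn A.integrand (fun x => 1 / ((1 + x 0 ^ 2) * x 1)) A.domain → Literature.NumberTheory.Transcendental.KZ.Equivalent N A := by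
  sorry

/-- STUB `stub_putnam` (rule 2, one `changeOfVariablesRel` instance + existence of the image representation): the
involution `Φ(s,y) = ((1−s)/(1+s), 2y/(1+s))`, `|det DΦ| = 4/(1+s)³`, maps `A = {0<s<1, 1<y≤1+s}` onto
`A* = {0<w<1, 1+w<y≤2}` with `g = (g ∘ Φ)·|det DΦ|` — the self-similarity behind `∫₀¹ log(1+s) ds/(1+s²) = (π/8) log 2`.
[cite: KontsevichZagier2001, §1.2 rule (2)] -/
theorem stub_putnam : ∀ A : Literature.NumberTheory.Transcendental.KZ.IntegralRep 2, A.domain = {x | 0 < x 0 ∧ x 0 < 1 ∧ 1 < x 1 ∧ x 1 ≤ 1 + x 0} → Set.EqOn A.integrand (fun x => 1 / ((1 + x 0 ^ 2) * x 1)) A.domain → (∃ As : Literature.NumberTheory.Transcendental.KZ.IntegralRep 2, As.domain = {x | 0 < x 0 ∧ x 0 < 1 ∧ 1 + x 0 < x 1 ∧ x 1 ≤ 2} ∧ Set.EqOn As.integrand (fun x => 1 / ((1 + x 0 ^ 2) * x 1)) As.domain) ∧ (∀ As : Literature.NumberTheory.Transcendental.KZ.IntegralRep 2, As.domain = {x |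 0 < x 0 ∧ x 0 < 1 ∧ 1 + x 0 < x 1 ∧ x 1 ≤ 2} → Set.EqOn As.integrand (fun x => 1 / ((1 + x 0 ^ 2) * x 1)) As.domain → Literature.NumberTheory.Transcendental.KZ.Equivalent A As) := by
  sorry

/-- STUB `stub_aToY` (rule 2, one `changeOfVariablesRel` instance + existence of the image representation): the
substitution `Φ(a,s) = (s, 2 − a(1+s²))`, `|det DΦ| = 1 + s²`, maps the half-closed square `{0≤a<1, 0<s<1}` onto
`T' = {0<s<1, 1−s²<y≤2}` and `1/(2 − a(1+s²)) = g(Φ(a,s))·(1+s²)`.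
[cite: KontsevichZagier2001, §1.2 rule (2)] -/
theorem stub_aToY : ∀ T : Literature.NumberTheory.Transcendental.KZ.IntegralRep 2, T.domain = {x | 0 ≤ x 0 ∧ x 0 < 1 ∧ 0 < x 1 ∧ x 1 < 1} → Set.EqOn T.integrand (fun x => 1 / (2 - x 0 * (1 + x 1 ^ 2))) T.domain → (∃ T' : Literature.NumberTheory.Transcendental.KZ.IntegralRep 2, T'.domain = {x | 0 < x 0 ∧ x 0 < 1 ∧ 1 - x 0 ^ 2 < x 1 ∧ x 1 ≤ 2} ∧ Set.EqOn T'.integrand (fun x => 1 / ((1 + x 0 ^ 2) * x 1)) T'.domain) ∧ (∀ T' : Literature.NumberTheory.Transcendental.KZ.IntegralRep 2, T'.domain = {x | 0 < x 0 ∧ x 0 < 1 ∧ 1 - x 0 ^ 2 < x 1 ∧ x 1 ≤ 2} → Set.EqOn T'.integrand (fun x => 1 / ((1 + x 0 ^ 2) * x 1)) T'.domain → Literature.NumberTheory.Transcendental.KZ.Equivalent T T') := by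
  sorry

/-- STUB `stub_shadowSquare` (rules 2, 1a, 1b; `ShadowSquareTetra` of the card, planar half): every flat-shadow
representation of `T(i)` — triangle `Δ(0,1,i) = {q₁>0, q₀>0, q₀+q₁<1}`, density `1/(2(q₀+q₁−q₀²−q₁²))`, written with
`z = Complex.I` literally so that the landed `tetraFlatten` applies — is KZ-equivalent to every shadow-square
representation `[[0,1)×(0,1), 1/(2 − a(1+s²))]`, and one such exists: the linear map `(a,s) ↦ (a(1+s)/2, a(1−s)/2)`
(`|det| = a/2`) from the rectangle `(0,1)×(−1,1)` onto the triangle pulls the density back to `1/(2(2−a(1+s²)))`,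
the reflection `s ↦ −s` identifies the two halves of the rectangle, `f = f/2 + f/2` (rule 1b) doubles, and the edges
`s = 0`, `a = 0` are null. [cite: Milnor1982, Appendix, Lemma 2] -/
theorem stub_shadowSquare : ∀ F : Literature.NumberTheory.Transcendental.KZ.IntegralRep 2, F.domain = {q | 0 < q 1 ∧ Complex.I.re * q 1 < Complex.I.im * q 0 ∧ Complex.I.im * (q 0 - 1) < (Complex.I.re - 1) * q 1} → Set.EqOn F.integrand (fun q => Complex.I.im / (2 * (Complex.I.im * (q 0 - q 0 ^ 2 - q 1 ^ 2) + (Complex.normSq Complex.I - Complex.I.re) * q 1))) F.domain → (∃ T : Literature.NumberTheory.Transcendental.KZ.IntegralRep 2, T.domain = {x | 0 ≤ x 0 ∧ x 0 < 1 ∧ 0 < x 1 ∧ x 1 < 1} ∧ Set.EqOn T.integrand (fun x => 1 / (2 - x 0 * (1 + x 1 ^ 2))) T.domain) ∧ (∀ T : Literature.NumberTheory.Transcendental.KZ.IntegralRep 2, T.domain = {x | 0 ≤ x 0 ∧ x 0 < 1 ∧ 0 < x 1 ∧ x 1 < 1} → Set.EqOn T.integrand (fun x => 1 / (2 - x 0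 * (1 + x 1 ^ 2))) T.domain → Literature.NumberTheory.Transcendental.KZ.Equivalent T F) := by
  sorry

/-! ## Composition of stage 1: TetrahedronCatalan inside the rules -/

/-- `Complex.I` is algebraic over `ℚ` (root of `X² + 1`). [folklore] -/
theorem isAlgebraic_complexI : IsAlgebraic ℚ Complex.I := by
  refine ⟨Polynomial.X ^ 2 + 1, ?_, ?_⟩
  · intro h
    have h2 := congrArg (Polynomial.eval 0) h
    simp at h2
  · simp [Complex.I_sq]

/-- **Catalan meets the shadow square** (`CatalanMeetsShadow` of card `deform-to-the-oracle`, in the half-closed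
bookkeeping of this line): every Catalan representation `[(0,1)², 1/(1+x²y²)]` is KZ-equivalent to every
shadow-square representation `[[0,1)×(0,1), 1/(2 − a(1+s²))]` — Cayley–shear, four dissections, `y`-rescaling, the
Putnam self-map, and the substitution `y = 2 − a(1+s²)`. [cite: KontsevichZagier2001, §1.2] -/
theorem catalanMeetsShadowSquare (κ T : KZ.IntegralRep 2)
    (hκ : κ.domain = {x | 0 < x 0 ∧ x 0 < 1 ∧ 0 < x 1 ∧ x 1 < 1})
    (hκi : EqOn κ.integrand (fun x => 1 / (1 + x 0 ^ 2 * x 1 ^ 2)) κ.domain)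
    (hT : T.domain = {x | 0 ≤ x 0 ∧ x 0 < 1 ∧ 0 < x 1 ∧ x 1 < 1})
    (hTi : EqOn T.integrand (fun x => 1 / (2 - x 0 * (1 + x 1 ^ 2))) T.domain) :
    KZ.Equivalent κ T := by
  obtain ⟨hDi, hDii, hDiii, hDiv, hDv, -⟩ := stub_dissect
  -- Catalan square: null edge, then Cayley–shear onto the band B
  obtain ⟨⟨K, hK, hKi⟩, hκK⟩ := hDi κ hκ hκi
  obtain ⟨⟨B, hB, hBi⟩, hKB⟩ := stub_cayleyShear K hK hKi
  -- dissections B = M ∪ A, M = N ∪ T₁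
  obtain ⟨⟨M, A, hM, hMi, hA, hAi⟩, hBMA⟩ := hDii B hB hBi
  obtain ⟨⟨N, T₁, hN, hNi, hT₁, hT₁i⟩, hMNT⟩ := hDiii M hM hMi
  -- shadow side: T ~ T' = T₁' ∪ P
  obtain ⟨⟨T', hT', hT'i⟩, hTT'⟩ := stub_aToY T hT hTi
  obtain ⟨⟨T₁', P, hT₁', hT₁'i, hP, hPi⟩, hT'TP⟩ := hDiv T' hT' hT'i
  -- Putnam: A ~ A*, and P = A ∪ A*
  obtain ⟨⟨As, hAs, hAsi⟩, hAAs⟩ := stub_putnam A hA hAi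
  have h1 : KZ.of κ - KZ.of K ∈ KZ.relations := hκK K hK hKi
  have h2 : KZ.of K - KZ.of B ∈ KZ.relations := hKB B hB hBi
  have h3 : KZ.of B - KZ.of M - KZ.of A ∈ KZ.relations := hBMA M A hM hMi hA hAi
  have h4 : KZ.of M - KZ.of N - KZ.of T₁ ∈ KZ.relations := hMNT N T₁ hN hNi hT₁ hT₁i
  have h5 : KZ.of N - KZ.of A ∈ KZ.relations := stub_yScale N A hN hNi hA hAi
  have h6 : KZ.of A - KZ.of As ∈ KZ.relations := hAAs As hAs hAsi
  have h7 : KZ.of P - KZ.of A - KZ.of As ∈ KZ.relations := hDv P A As hP hPi hA hAi hAs hAsi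
  have h8 : KZ.of T' - KZ.of T₁' - KZ.of P ∈ KZ.relations := hT'TP T₁' P hT₁' hT₁'i hP hPi
  have h9 : KZ.of T - KZ.of T' ∈ KZ.relations := hTT' T' hT' hT'i
  -- the two restrictions to T₁ agree (same domain, integrands agree on it)
  have h10 : KZ.of T₁ - KZ.of T₁' ∈ KZ.relations :=
    KZ.of_sub_of_mem_relations_of_eqOn (hT₁'.trans hT₁.symm) fun x hx =>
      (hT₁i hx).trans (hT₁'i (by rw [hT₁', ← hT₁]; exact hx)).symm
  have key : KZ.of κ - KZ.of T =
      (KZ.of κ - KZ.of K) + (KZ.of K - KZ.of B) + (KZ.of B - KZ.of M - KZ.of A) +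
        (KZ.of M - KZ.of N - KZ.of T₁) + (KZ.of N - KZ.of A) + (KZ.of A - KZ.of As) -
        (KZ.of P - KZ.of A - KZ.of As) - (KZ.of T' - KZ.of T₁' - KZ.of P) -
        (KZ.of T - KZ.of T') + (KZ.of T₁ - KZ.of T₁') := by
    abel
  show KZ.of κ - KZ.of T ∈ KZ.relations
  rw [key]
  exact add_mem (sub_mem (sub_mem (sub_mem (add_mem (add_mem (add_mem (add_mem (add_mem h1 h2) h3) h4)
    h5) h6) h7) h8) h9) h10

/-- **TetrahedronCatalan inside Kontsevich–Zagier's rules** (calibration of line `deform-to-the-oracle`; the unfiled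
layer-2 item `TetrahedronCatalan` of route BianchiHumbert, "`D(i) = G` as moves"): every Catalan representation
`[(0,1)², 1/(1+x²y²)]` (value `G = 0.9159655942…`, Catalan's constant) is KZ-EQUIVALENT to every representation of the
ideal tetrahedron `[T(∞,0,1,i), t⁻³]` (value `vol T(i) = D(i)`). Chain: `catalanMeetsShadowSquare`, then the linear
map onto the flat shadow of `T(i)` (`stub_shadowSquare`), then the landed cusp descent `tetraFlatten` at `z = i`.
[cite: Milnor1982, Appendix, Lemma 2] -/
theorem catalanMeetsTetra (κ : KZ.IntegralRep 2) (r : KZ.IntegralRep 3)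
    (hκ : κ.domain = {x | 0 < x 0 ∧ x 0 < 1 ∧ 0 < x 1 ∧ x 1 < 1})
    (hκi : EqOn κ.integrand (fun x => 1 / (1 + x 0 ^ 2 * x 1 ^ 2)) κ.domain)
    (hr : r.domain = idealTetrahedron Complex.I) (hri : EqOn r.integrand (fun p => 1 / p 2 ^ 3) r.domain) :
    KZ.Equivalent κ r := by
  obtain ⟨F, hF, hFi⟩ := exists_flatRep Complex.I isAlgebraic_complexI (by simp)
  obtain ⟨⟨T, hT, hTi⟩, hTF⟩ := stub_shadowSquare F hF hFi
  have hrF : KZ.Equivalent r F := tetraFlatten Complex.I isAlgebraic_complexI (by simp) r F hr hri hF hFi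
  exact ((catalanMeetsShadowSquare κ T hκ hκi hT hTi).trans (hTF T hT hTi)).trans hrF.symm

/-- Corollary from the soundness of the calculus: **`∫∫_{(0,1)²} dx dy/(1+x²y²) = vol T(i)`** (`= G`), i.e. Catalan's
constant IS the volume of the ideal tetrahedron `(∞,0,1,i)`, obtained by moves. [cite: Milnor1982, Appendix, Lemma 2] -/
theorem catalan_value_eq_idealTetrahedronVolume (κ : KZ.IntegralRep 2)
    (hκ : κ.domain = {x | 0 < x 0 ∧ x 0 < 1 ∧ 0 < x 1 ∧ x 1 < 1})
    (hκi : EqOn κ.integrand (fun x => 1 / (1 + x 0 ^ 2 * x 1 ^ 2)) κ.domain) :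
    κ.value = idealTetrahedronVolume Complex.I := by
  rw [← KZ.value_idealTetrahedronRep Complex.I isAlgebraic_complexI (by simp)]
  exact KZ.Equivalent.value_eq_holds
    (catalanMeetsTetra κ _ hκ hκi rfl (fun _ _ => rfl))

/-! ## The remainder and the transfer certificate -/

/-- STUB (the remainder `OffCatalan`, transfer `C⁺`, crux-equivalent by `offTetraSectorKernel_iff_offCatalan` and hence
summit-strength — NOT a proof target of this line): the kernel form of Conjecture 1 with the oracle of zero-sum
ℤ-combinations of ideal tetrahedra `[T(z), t⁻³]` (`z ∈ ℚ̄ ∩ ℍ⁺`) AND Catalan squares `[(0,1)², 1/(1+x²y²)]` adjoined.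
[cite: KontsevichZagier2001, §1.2 Conjecture 1] -/
theorem stub_offCatalan : ∀ c : Literature.NumberTheory.Transcendental.KZ.FormalRep, Literature.NumberTheory.Transcendental.KZ.eval c = 0 → c ∈ Literature.NumberTheory.Transcendental.KZ.relations ⊔ AddSubgroup.closure ({d : Literature.NumberTheory.Transcendental.KZ.FormalRep | ∃ ρ : ℂ → Literature.NumberTheory.Transcendental.KZ.IntegralRep 3, (∀ z, IsAlgebraic ℚ z → 0 < z.im → (ρ z).domain = Literature.NumberTheory.Transcendental.idealTetrahedron z ∧ Set.EqOn (ρ z).integrand (fun p => 1 / p 2 ^ 3) (Literature.NumberTheory.Transcendental.idealTetrahedron z)) ∧ ∃ (k : ℕ) (z : Fin k → ℂ) (n : Fin k → ℤ), (∀ i, IsAlgebraic ℚ (z i)) ∧ (∀ i, 0 < (z i).im) ∧ ∑ i, (n i : ℝ) * (ρ (z i)).value = 0 ∧ d = ∑ i, n i • Literature.NumberTheory.Transcendental.KZ.of (ρ (z i))} ∪ {d : Literature.NumberTheory.Transcendental.KZ.FormalRep | ∃ ρ : ℂ → Literature.NumberTheory.Transcendental.KZ.IntegralRep 3, (∀ z,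 IsAlgebraic ℚ z → 0 < z.im → (ρ z).domain = Literature.NumberTheory.Transcendental.idealTetrahedron z ∧ Set.EqOn (ρ z).integrand (fun p => 1 / p 2 ^ 3) (Literature.NumberTheory.Transcendental.idealTetrahedron z)) ∧ ∃ κ : Literature.NumberTheory.Transcendental.KZ.IntegralRep 2, κ.domain = {x | 0 < x 0 ∧ x 0 < 1 ∧ 0 < x 1 ∧ x 1 < 1} ∧ Set.EqOn κ.integrand (fun x => 1 / (1 + x 0 ^ 2 * x 1 ^ 2)) κ.domain ∧ ∃ (m : ℤ) (k : ℕ) (z : Fin k → ℂ) (n : Fin k → ℤ), (∀ i, IsAlgebraic ℚ (z i)) ∧ (∀ i, 0 < (z i).im) ∧ (m : ℝ) * κ.value + ∑ i, (n i : ℝ) * (ρ (z i)).value = 0 ∧ d = m • Literature.NumberTheory.Transcendental.KZ.of κ + ∑ i, n i • Literature.NumberTheory.Transcendental.KZ.of (ρ (z i))}) := by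
  sorry

/-- **Transfer certificate of the remainder** (`Off ↔ OffCatalan`): adjoining the Catalan squares to the oracle does not
change the crux, because each Catalan square is KZ-equivalent to the oracle generator `[T(i), t⁻³]`
(`catalanMeetsTetra`), so every enlarged zero-sum `m[κ] + Σ nᵢ[ρ zᵢ]` is congruent modulo `relations` to the tetrahedral
zero-sum `m[ρ i] + Σ nᵢ[ρ zᵢ]`. [cite: KontsevichZagier2001, §1.2] -/
theorem offTetraSectorKernel_iff_offCatalan : Summit.KontsevichZagierPeriods.KontsevichZagierPeriods.Theses.HyperbolicBloch.OffTetraSectorKernel ↔ (∀ c : Literature.NumberTheory.Transcendental.KZ.FormalRep, Literature.NumberTheory.Transcendental.KZ.eval c = 0 → c ∈ Literature.NumberTheory.Transcendental.KZ.relations ⊔ AddSubgroup.closure ({d : Literature.NumberTheory.Transcendental.KZ.FormalRep | ∃ ρ : ℂ → Literature.NumberTheory.Transcendental.KZ.IntegralRep 3, (∀ z, IsAlgebraic ℚ z → 0 < z.im → (ρ z).domain = Literature.NumberTheory.Transcendental.idealTetrahedron z ∧ Set.EqOn (ρ z).integrand (fun p => 1 / p 2 ^ 3) (Literature.NumberTheory.Transcendental.idealTetrahedron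 z)) ∧ ∃ (k : ℕ) (z : Fin k → ℂ) (n : Fin k → ℤ), (∀ i, IsAlgebraic ℚ (z i)) ∧ (∀ i, 0 < (z i).im) ∧ ∑ i, (n i : ℝ) * (ρ (z i)).value = 0 ∧ d = ∑ i, n i • Literature.NumberTheory.Transcendental.KZ.of (ρ (z i))} ∪ {d : Literature.NumberTheory.Transcendental.KZ.FormalRep | ∃ ρ : ℂ → Literature.NumberTheory.Transcendental.KZ.IntegralRep 3, (∀ z, IsAlgebraic ℚ z → 0 < z.im → (ρ z).domain = Literature.NumberTheory.Transcendental.idealTetrahedron z ∧ Set.EqOn (ρ z).integrand (fun p => 1 / p 2 ^ 3) (Literature.NumberTheory.Transcendental.idealTetrahedron z)) ∧ ∃ κ : Literature.NumberTheory.Transcendental.KZ.IntegralRep 2, κ.domain = {x | 0 < x 0 ∧ x 0 < 1 ∧ 0 < x 1 ∧ x 1 < 1} ∧ Set.EqOn κ.integrand (fun x => 1 / (1 + x 0 ^ 2 * x 1 ^ 2)) κ.domain ∧ ∃ (m : ℤ) (k : ℕ) (z : Fin k → ℂ) (n : Fin k → ℤ), (∀ i, IsAlgebraic ℚ (z i))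 ∧ (∀ i, 0 < (z i).im) ∧ (m : ℝ) * κ.value + ∑ i, (n i : ℝ) * (ρ (z i)).value = 0 ∧ d = m • Literature.NumberTheory.Transcendental.KZ.of κ + ∑ i, n i • Literature.NumberTheory.Transcendental.KZ.of (ρ (z i))})) := by
  constructor
  · intro hO c hc
    have hmem := hO idealTetrahedron (fun _ => rfl) c hc
    exact sup_le_sup_left (AddSubgroup.closure_mono subset_union_left) _ hmem
  · intro hC T hT c hc
    have hTe : T = idealTetrahedron := funext fun z => (hT z).trans rfl
    subst hTe
    refine sup_closure_le_of_exchange ?_ (hC c hc)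
    rintro a (ha | ⟨ρ, hρ, κ, hκ, hκi, m, k, z, n, halg, him, hsum, rfl⟩)
    · exact ⟨a, AddSubgroup.subset_closure ha, by simp⟩
    · have hI : IsAlgebraic ℚ Complex.I := isAlgebraic_complexI
      have hIim : 0 < Complex.I.im := by simp
      have hE : KZ.Equivalent κ (ρ Complex.I) :=
        catalanMeetsTetra κ (ρ Complex.I) hκ hκi (hρ _ hI hIim).1
          (by rw [(hρ _ hI hIim).1]; exact (hρ _ hI hIim).2)
      have hval : (ρ Complex.I).value = κ.value := (KZ.Equivalent.value_eq_holds hE).symm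
      refine ⟨∑ j : Fin (k + 1), (Fin.cons m n : Fin (k + 1) → ℤ) j •
          KZ.of (ρ ((Fin.cons Complex.I z : Fin (k + 1) → ℂ) j)), ?_, ?_⟩
      · refine AddSubgroup.subset_closure ⟨ρ, hρ, k + 1, Fin.cons Complex.I z, Fin.cons m n, ?_, ?_, ?_, rfl⟩
        · intro j
          refine Fin.cases ?_ (fun i => ?_) j
          · simpa using hI
          · simpa using halg i
        · intro j
          refine Fin.cases ?_ (fun i => ?_) j
          · simp
          · simpa using him i
        · rw [Fin.sum_univ_succ]
          simpa [hval] using hsum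
      · rw [Fin.sum_univ_succ]
        simp only [Fin.cons_zero, Fin.cons_succ]
        have : m • KZ.of κ + ∑ i, n i • KZ.of (ρ (z i)) -
            (m • KZ.of (ρ Complex.I) + ∑ i, n i • KZ.of (ρ (z i))) =
            m • (KZ.of κ - KZ.of (ρ Complex.I)) := by
          rw [smul_sub]; abel
        rw [this]
        exact zsmul_mem hE _

/-- **The sharp form of the residue** (`Off ↔ EnvelopeKernel`): the crux says exactly that every formal ℤ-combination
of integral representations with value `0` is, modulo Kontsevich–Zagier's moves, a ℤ-combination of the ideal
tetrahedra `KZ.idealTetrahedronRep z` (`z ∈ ℚ̄ ∩ ℍ⁺`) — the converse of the envelope principle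
`offTetraSectorKernel_on_envelope`. [cite: KontsevichZagier2001, §1.2 Conjecture 1] -/
theorem offTetraSectorKernel_iff_envelopeKernel :
    Summit.KontsevichZagierPeriods.KontsevichZagierPeriods.Theses.HyperbolicBloch.OffTetraSectorKernel ↔
      ∀ c : KZ.FormalRep, KZ.eval c = 0 → ∃ (k : ℕ) (z : Fin k → ℂ) (n : Fin k → ℤ)
        (halg : ∀ i, IsAlgebraic ℚ (z i)) (him : ∀ i, 0 < (z i).im),
        c - ∑ i, n i • KZ.of (KZ.idealTetrahedronRep (z i) (halg i) (him i)) ∈ KZ.relations := by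
  classical
  -- the canonical admissible family
  set ρ₀ : ℂ → KZ.IntegralRep 3 := fun z =>
    if h : IsAlgebraic ℚ z ∧ 0 < z.im then KZ.idealTetrahedronRep z h.1 h.2 else KZ.IntegralRep.empty 3
    with hρ₀_def
  have hρ₀ : ∀ z (hz : IsAlgebraic ℚ z) (him : 0 < z.im), ρ₀ z = KZ.idealTetrahedronRep z hz him := by
    intro z hz him
    simp only [hρ₀_def, dif_pos (show IsAlgebraic ℚ z ∧ 0 < z.im from ⟨hz, him⟩)]
  have hρ₀adm : ∀ z, IsAlgebraic ℚ z → 0 < z.im →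
      (ρ₀ z).domain = idealTetrahedron z ∧ EqOn (ρ₀ z).integrand (fun p => 1 / p 2 ^ 3) (idealTetrahedron z) := by
    intro z hz him
    rw [hρ₀ z hz him]
    exact ⟨rfl, fun _ _ => rfl⟩
  constructor
  · intro hO c hc
    have hmem := hO idealTetrahedron (fun _ => rfl) c hc
    -- every element of `relations ⊔ closure oracle` is a relation plus a ρ₀-combination
    have key : ∀ x ∈ KZ.relations ⊔ AddSubgroup.closure {d : KZ.FormalRep | ∃ ρ : ℂ → KZ.IntegralRep 3,
        (∀ z, IsAlgebraic ℚ z → 0 < z.im → (ρ z).domain = idealTetrahedron z ∧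
          EqOn (ρ z).integrand (fun p => 1 / p 2 ^ 3) (idealTetrahedron z)) ∧
        ∃ (k : ℕ) (z : Fin k → ℂ) (n : Fin k → ℤ), (∀ i, IsAlgebraic ℚ (z i)) ∧ (∀ i, 0 < (z i).im) ∧
          ∑ i, (n i : ℝ) * (ρ (z i)).value = 0 ∧ d = ∑ i, n i • KZ.of (ρ (z i))},
        ∃ (k : ℕ) (z : Fin k → ℂ) (n : Fin k → ℤ), (∀ i, IsAlgebraic ℚ (z i)) ∧ (∀ i, 0 < (z i).im) ∧
          x - ∑ i, n i • KZ.of (ρ₀ (z i)) ∈ KZ.relations := by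
      intro x hx
      rw [AddSubgroup.mem_sup] at hx
      obtain ⟨y, hy, w, hw, rfl⟩ := hx
      suffices hw' : ∃ (k : ℕ) (z : Fin k → ℂ) (n : Fin k → ℤ), (∀ i, IsAlgebraic ℚ (z i)) ∧
          (∀ i, 0 < (z i).im) ∧ w - ∑ i, n i • KZ.of (ρ₀ (z i)) ∈ KZ.relations by
        obtain ⟨k, z, n, halg, him, hw'⟩ := hw'
        refine ⟨k, z, n, halg, him, ?_⟩
        have : y + w - ∑ i, n i • KZ.of (ρ₀ (z i)) = y + (w - ∑ i, n i • KZ.of (ρ₀ (z i))) := by abel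
        rw [this]
        exact add_mem hy hw'
      refine AddSubgroup.closure_induction (p := fun x _ => ∃ (k : ℕ) (z : Fin k → ℂ) (n : Fin k → ℤ),
        (∀ i, IsAlgebraic ℚ (z i)) ∧ (∀ i, 0 < (z i).im) ∧ x - ∑ i, n i • KZ.of (ρ₀ (z i)) ∈ KZ.relations)
        ?_ ⟨0, Fin.elim0, Fin.elim0, fun i => i.elim0, fun i => i.elim0, by simp⟩ ?_ ?_ hw
      · rintro x ⟨ρ, hρ, k, z, n, halg, him, -, rfl⟩
        refine ⟨k, z, n, halg, him, ?_⟩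
        rw [← Finset.sum_sub_distrib]
        refine sum_mem fun i _ => ?_
        rw [← smul_sub]
        refine zsmul_mem (KZ.of_sub_of_mem_relations_of_eqOn ?_ ?_) _
        · rw [(hρ₀adm _ (halg i) (him i)).1, (hρ _ (halg i) (him i)).1]
        · intro p hp
          rw [(hρ _ (halg i) (him i)).1] at hp
          exact ((hρ _ (halg i) (him i)).2 hp).trans ((hρ₀adm _ (halg i) (him i)).2 hp).symm
      · rintro x y _ _ ⟨k, z, n, hz, him, hx⟩ ⟨k', z', n', hz', him', hy⟩
        refine ⟨k + k', Fin.append z z', Fin.append n n', ?_, ?_, ?_⟩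
        · intro i
          refine Fin.addCases (fun j => ?_) (fun j => ?_) i
          · simpa [Fin.append_left] using hz j
          · simpa [Fin.append_right] using hz' j
        · intro i
          refine Fin.addCases (fun j => ?_) (fun j => ?_) i
          · simpa [Fin.append_left] using him j
          · simpa [Fin.append_right] using him' j
        · rw [Fin.sum_univ_add]
          simp only [Fin.append_left, Fin.append_right]
          have : x + y - (∑ i : Fin k, n i • KZ.of (ρ₀ (z i)) + ∑ i : Fin k', n' i • KZ.of (ρ₀ (z' i))) =
              (x - ∑ i, n i • KZ.of (ρ₀ (z i))) + (y - ∑ i, n' i • KZ.of (ρ₀ (z' i))) := by abel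
          rw [this]
          exact add_mem hx hy
      · rintro x _ ⟨k, z, n, hz, him, hx⟩
        refine ⟨k, z, -n, hz, him, ?_⟩
        have : -x - ∑ i, (-n) i • KZ.of (ρ₀ (z i)) = -(x - ∑ i, n i • KZ.of (ρ₀ (z i))) := by
          simp [neg_smul, Finset.sum_neg_distrib]; abel
        rw [this]
        exact neg_mem hx
    obtain ⟨k, z, n, halg, him, hx⟩ := key c hmem
    refine ⟨k, z, n, halg, him, ?_⟩
    have hρz : ∀ i, ρ₀ (z i) = KZ.idealTetrahedronRep (z i) (halg i) (him i) := fun i => hρ₀ _ _ _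
    simpa [hρz] using hx
  · intro hE T hT c hc
    have hTe : T = idealTetrahedron := funext fun z => (hT z).trans rfl
    subst hTe
    obtain ⟨k, z, n, halg, him, hct⟩ := hE c hc
    have hρz : ∀ i, KZ.idealTetrahedronRep (z i) (halg i) (him i) = ρ₀ (z i) := fun i => (hρ₀ _ _ _).symm
    simp only [hρz] at hct
    exact offTetraSectorKernel_on_envelope idealTetrahedron ρ₀ hρ₀adm
      (AddSubgroup.subset_closure ⟨k, z, n, halg, him, hct⟩) hc

/-- **The line closes the crux modulo its remainder**: `OffCatalan ⇒ Off` by the transfer certificate (which consumes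
the six calibration stubs through `catalanMeetsTetra`). [cite: KontsevichZagier2001, §1.2] -/
theorem OffTetraSectorKernel_of :
    Summit.KontsevichZagierPeriods.KontsevichZagierPeriods.Theses.HyperbolicBloch.OffTetraSectorKernel :=
  offTetraSectorKernel_iff_offCatalan.mpr stub_offCatalan

end Summit.KontsevichZagierPeriods.HyperbolicBloch.OffTetraSectorKernel

end
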